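import Literature.Analysis.FluidPDE.AncientMildDrift
import Literature.Analysis.FluidPDE.AncientMildModification
import Literature.Analysis.FluidPDE.KNSSThm52OfProp41
import Mathlib.MeasureTheory.Measure.SeparableMeasure
import HarnessLib

/-!
# KNSS 2009, Theorem 5.2: the slice-wise facts follow from the theorem in print

Analysis/FluidPDE support file (all results proved) for the named facts
`Literature.Analysis.FluidPDE.knss_axisymmetric_no_swirl` and
`Literature.Analysis.FluidPDE.knss_axisymmetric_no_swirl'` (`SelfSimilarLiouville`;
Koch–Nadirashvili–Seregin–Šverák, Acta Math. 203 (2009) = arXiv:0709.3599, Theorem 5.2: "Let `u`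
be a bounded weak solution of the Navier–Stokes equations in `ℝ³ × (−∞, 0)`. Assume that `u` is
axi-symmetric with no swirl. Then `u(x,t) = (0, 0, b₃(t))` for some bounded measurable
`b₃ : (−∞, 0) → ℝ`"). Those facts ask only for measurable *slices* of a bounded ancient mild
solution in the tree's duality form, a class strictly larger than print's `L^∞(ℝ³ × (−∞, 0))`
(`isBoundedAncientMildSolution_timeConst`: the spatially constant drift `b(t)` of KNSS 2009, §1
p. 3 may be non-measurable in the duality-form class), and were recorded with a class-mismatch
caveat. This file closes the gap:

* `knss_axisymmetric_no_swirl_of_KNSS2009 :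
    KNSS2009_liouville_axisymmetric_no_swirl → knss_axisymmetric_no_swirl` (**proved**), and the
  `ℝ³`-valued form `knss_axisymmetric_no_swirl'_of_KNSS2009`;
* hence both slice-wise facts from KNSS's §4 regularity fact alone,
  `knss_axisymmetric_no_swirl_of_prop41_mild`, `knss_axisymmetric_no_swirl'_of_prop41_mild`
  (through `KNSSThm52OfProp41`): when `KNSS2009_prop41_mild` is discharged these are the
  discharges of the two facts.

## The reduction (docstring of `knss_axisymmetric_no_swirl_of_KNSS2009`)

The slice-wise class is the printed class up to a possibly non-measurable axial drift `c(t) e_z`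
(`AncientMildModification`: a jointly measurable modification exists modulo the axial average).
The drift enters the duality identity only through the cross term `c(τ) ∫⟪w τ, ∂_z e^{(q−τ)Δ}φ⟫`
(`integral_inner_convect_heatTest_add_const`). Where the slices are not a.e. constant the identity
is honest (`AncientMildDrift`, the heat regime) and pins `c` measurably wherever some cross term
is non-zero; where every cross term vanishes in the limit of small times the slice is invariant
under the vertical translations (this file: `integral_inner_fderiv_heatTest_eq_zero_of_dense`,
`integral_inner_fderiv_eq_zero_of_tendsto`,
`ae_eq_comp_add_smul_of_forall_integral_inner_fderiv_eq_zero`), and there the drift may be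
replaced by zero without leaving the class (the drift lemma of `AncientMildDrift`). The resulting
jointly measurable field is a bounded weak solution to which the printed theorem applies.

## References

* G. Koch, N. Nadirashvili, G. Seregin, V. Šverák, *Liouville theorems for the Navier–Stokes
  equations and applications*, Acta Math. 203 (2009) 83–105 = arXiv:0709.3599, Thm 5.2
  pp. 9–10, §1 p. 3 (the parasitic solutions `u(x,t) = b(t)`), §3 p. 7 and §4 (i)–(ii) p. 8 (the
  class `L^∞(ℝ³ × (−∞, 0))`, `b` bounded measurable). [KochNadirashviliSereginSverak2009]
-/

noncomputable section

open MeasureTheory Set Function Filter Topology TopologicalSpace InnerProductSpace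
open scoped RealInnerProductSpace NNReal ENNReal ContDiff Laplacian

namespace Literature.Analysis.FluidPDE

variable {E : Type*} [NormedAddCommGroup E] [InnerProductSpace ℝ E] [FiniteDimensional ℝ E]
  [MeasurableSpace E] [BorelSpace E]

/-! ### The nonlinear integrand of a field plus a spatial constant -/

section Algebra

/-- **The nonlinear integrand of `v + a e`.** For `v` bounded, measurable and weakly divergence
free, a scalar `a`, a vector `e` and a test field `φ`,
`∫⟪v + a e, ((v + a e)·∇) e^{νσΔ}φ⟫ = ∫⟪v, (v·∇) e^{νσΔ}φ⟫ + a ∫⟪v, ∂ₑ e^{νσΔ}φ⟫`: the two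
remaining cross terms vanish, `∫⟪ae, (v·∇)ψ⟫ = 0` by weak divergence-freeness
(`IsWeaklyDivFree.integral_inner_const_fderiv_heatTest_apply_eq_zero`) and `∫⟪ae, ∂_{ae}ψ⟫ = 0`
(`integral_inner_const_fderiv_heatFlow_eq_zero`). The surviving cross term `a ∫⟪v, ∂ₑψ⟫` is
the drift term through which the spatial constant of KNSS 2009, §1 p. 3 enters the duality
identity. [folklore] -/
theorem integral_inner_convect_heatTest_add_const {v : E → E}
    (hv : AEStronglyMeasurable v volume) {M : ℝ} (hM : ∀ x, ‖v x‖ ≤ M) (hdiv : IsWeaklyDivFree v)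
    (a : ℝ) (e : E) {φ : E → E} (hφ : FunctionSpaces.IsTestFunctionOn (⊤ : Opens E) φ) (ν σ : ℝ) :
    ∫ x, ⟪v x + a • e, convect (fun y => v y + a • e) (heatTest ν φ σ) x⟫ =
      (∫ x, ⟪v x, convect v (heatTest ν φ σ) x⟫) + a * ∫ x, ⟪v x, fderiv ℝ (heatTest ν φ σ) x e⟫ := by
  have hφ1 : ContDiff ℝ 1 φ := hφ.contDiff.of_le (by exact_mod_cast le_top)
  set ψ := heatTest ν φ σ with hψ_def
  have hDe_c : Continuous fun z => fderiv ℝ φ z e := (hφ1.continuous_fderiv one_ne_zero).clm_apply continuous_const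
  have hDe_i : Integrable fun x => fderiv ℝ ψ x e := by
    have : Integrable (heatFlow (fun z => fderiv ℝ φ z e) (ν * σ)) :=
      integrable_heatFlow (hDe_c.integrable_of_hasCompactSupport (hφ.hasCompactSupport.fderiv_apply (𝕜 := ℝ) e)) _
    exact this.congr (Eventually.of_forall fun x => (fderiv_heatFlow_apply hφ1 hφ.hasCompactSupport _ x e).symm)
  have iA : Integrable fun x => ⟪v x, fderiv ℝ ψ x (v x)⟫ := by
    simpa only [convect_apply] using integrable_inner_convect_heatTest hv hM hφ ν σ
  have iB : Integrable fun x => ⟪v x, a • fderiv ℝ ψ x e⟫ :=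
    integrable_inner_of_aestronglyMeasurable_of_norm_le hv hM (hDe_i.smul a)
  have iC : Integrable fun x => ⟪a • e, fderiv ℝ ψ x (v x)⟫ := by
    simpa only [convect_apply] using (integrable_convect_heatTest hv hM hφ ν σ).const_inner (a • e)
  have iD : Integrable fun x => ⟪a • e, a • fderiv ℝ ψ x e⟫ := (hDe_i.smul a).const_inner (a • e)
  have eB : ∫ x, ⟪v x, a • fderiv ℝ ψ x e⟫ = a * ∫ x, ⟪v x, fderiv ℝ ψ x e⟫ := by
    simp_rw [real_inner_smul_right]
    exact integral_const_mul _ _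
  have eC : ∫ x, ⟪a • e, fderiv ℝ ψ x (v x)⟫ = 0 :=
    hdiv.integral_inner_const_fderiv_heatTest_apply_eq_zero hv hM (a • e) hφ ν σ
  have eD : ∫ x, ⟪a • e, a • fderiv ℝ ψ x e⟫ = 0 := by
    simp_rw [real_inner_smul_right]
    rw [integral_const_mul, hψ_def, show heatTest ν φ σ = heatFlow φ (ν * σ) from rfl,
      integral_inner_const_fderiv_heatFlow_eq_zero hφ1 hφ.hasCompactSupport (ν * σ) (a • e) e, mul_zero]
  have iAC : Integrable fun x => ⟪v x, fderiv ℝ ψ x (v x)⟫ + ⟪a • e, fderiv ℝ ψ x (v x)⟫ := iA.add iC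
  have iBD : Integrable fun x => ⟪v x, a • fderiv ℝ ψ x e⟫ + ⟪a • e, a • fderiv ℝ ψ x e⟫ := iB.add iD
  calc ∫ x, ⟪v x + a • e, convect (fun y => v y + a • e) ψ x⟫
      = ∫ x, (⟪v x, fderiv ℝ ψ x (v x)⟫ + ⟪a • e, fderiv ℝ ψ x (v x)⟫) +
          (⟪v x, a • fderiv ℝ ψ x e⟫ + ⟪a • e, a • fderiv ℝ ψ x e⟫) :=
        integral_congr_ae (Eventually.of_forall fun x => by
          simp only [convect_apply, map_add, map_smul, inner_add_left, inner_add_right])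
    _ = ((∫ x, ⟪v x, fderiv ℝ ψ x (v x)⟫) + ∫ x, ⟪a • e, fderiv ℝ ψ x (v x)⟫) +
          ((∫ x, ⟪v x, a • fderiv ℝ ψ x e⟫) + ∫ x, ⟪a • e, a • fderiv ℝ ψ x e⟫) := by
        rw [integral_add iAC iBD, integral_add iA iC, integral_add iB iD]
    _ = (∫ x, ⟪v x, fderiv ℝ ψ x (v x)⟫) + a * ∫ x, ⟪v x, fderiv ℝ ψ x e⟫ := by
        rw [eB, eC, eD]; ring
    _ = (∫ x, ⟪v x, convect v ψ x⟫) + a * ∫ x, ⟪v x, fderiv ℝ ψ x e⟫ := by simp only [convect_apply]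

/-- **The nonlinear integrand only depends on the a.e. class of the slice.** [folklore] -/
theorem integral_inner_convect_heatTest_congr_ae {v v' : E → E} (h : v =ᵐ[volume] v')
    (ψ : E → E) : ∫ x, ⟪v x, convect v ψ x⟫ = ∫ x, ⟪v' x, convect v' ψ x⟫ :=
  integral_congr_ae (by filter_upwards [h] with x hx; simp only [convect_apply, hx])

end Algebra

/-! ### A countable `L¹`-dense family of divergence-free test fields -/

section Dense

/-- **Divergence-free test fields have a countable `L¹`-dense subfamily**: there is a sequence
`φₖ` of smooth compactly supported divergence-free fields such that every such field is an
`L¹`-limit of a subsequence (`L¹` is second countable, so the image of the family in `L¹` is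
separable). [folklore] -/
theorem exists_seq_isDivFree_dense :
    ∃ φ : ℕ → E → E, (∀ k, FunctionSpaces.IsTestFunctionOn (⊤ : Opens E) (φ k) ∧ VectorCalculus.IsDivFree (φ k)) ∧
      ∀ ψ : E → E, FunctionSpaces.IsTestFunctionOn (⊤ : Opens E) ψ → VectorCalculus.IsDivFree ψ →
        ∀ ε > 0, ∃ k, ∫ x, ‖ψ x - φ k x‖ < ε := by
  classical
  set T : Set (E → E) := {ψ | FunctionSpaces.IsTestFunctionOn (⊤ : Opens E) ψ ∧ VectorCalculus.IsDivFree ψ} with hT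
  have hTi : ∀ ψ : T, Integrable (ψ : E → E) := fun ψ =>
    ψ.2.1.contDiff.continuous.integrable_of_hasCompactSupport ψ.2.1.hasCompactSupport
  haveI : Fact ((1 : ℝ≥0∞) ≤ 1) := ⟨le_rfl⟩
  haveI : Fact ((1 : ℝ≥0∞) ≠ (⊤ : ℝ≥0∞)) := ⟨ENNReal.one_ne_top⟩
  set ι : T → Lp E 1 (volume : Measure E) := fun ψ => (hTi ψ).toL1 (ψ : E → E) with hι
  -- the zero field is in `T`
  have h0T : (0 : E → E) ∈ T :=
    ⟨FunctionSpaces.isTestFunctionOn_zero ⊤, fun x => by simp [VectorCalculus.divergence]⟩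
  -- a countable dense subset of the range of `ι`
  obtain ⟨d, hdc, hdd⟩ := TopologicalSpace.exists_countable_dense (range ι)
  haveI : Nonempty (range ι) := ⟨⟨ι ⟨0, h0T⟩, mem_range_self _⟩⟩
  have hdne : d.Nonempty := hdd.nonempty
  obtain ⟨f, hf⟩ := hdc.exists_eq_range hdne
  -- lift the sequence to `T`
  have hlift : ∀ k, ∃ ψ : T, ι ψ = (f k : Lp E 1 (volume : Measure E)) := fun k => (f k).2
  choose ψs hψs using hlift
  refine ⟨fun k => (ψs k : E → E), fun k => (ψs k).2, fun ψ hψ hdiv ε hε => ?_⟩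
  have hψT : ψ ∈ T := ⟨hψ, hdiv⟩
  set p : range ι := ⟨ι ⟨ψ, hψT⟩, mem_range_self _⟩ with hp
  have hpc : p ∈ closure d := hdd p
  obtain ⟨q, hq, hpq⟩ := Metric.mem_closure_iff.1 hpc ε hε
  have hq' : q ∈ range f := hf ▸ hq
  obtain ⟨k, rfl⟩ := hq'
  refine ⟨k, ?_⟩
  -- the distance in the subtype is the `L¹` distance of the representatives
  have hdist : dist p (f k) = ∫ x, ‖ψ x - (ψs k : E → E) x‖ := by
    rw [Subtype.dist_eq, hp]
    dsimp only
    rw [← hψs k, hι]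
    dsimp only
    have hmeas' : AEStronglyMeasurable (fun x => ψ x - (ψs k : E → E) x) volume :=
      ((hTi ⟨ψ, hψT⟩).sub (hTi (ψs k))).aestronglyMeasurable
    rw [dist_eq_norm, ← Integrable.toL1_sub, Integrable.norm_toL1, integral_norm_eq_lintegral_enorm hmeas']
    congr 1
    exact lintegral_congr fun x => by simp
  rw [← hdist]
  exact hpq

end Dense

/-! ### Slices annihilating the `e`-derivatives of the solenoidal tests are invariant along `e` -/

section Invariance

omit [FiniteDimensional ℝ E] [MeasurableSpace E] [BorelSpace E] in
/-- A translate `φ(· + b)` of a test field is a test field. [folklore] -/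
theorem _root_.Literature.Analysis.FunctionSpaces.IsTestFunctionOn.comp_add_right' {F : Type*}
    [NormedAddCommGroup F] [NormedSpace ℝ F] {φ : E → F}
    (hφ : FunctionSpaces.IsTestFunctionOn (⊤ : Opens E) φ) (b : E) :
    FunctionSpaces.IsTestFunctionOn (⊤ : Opens E) fun x => φ (x + b) :=
  ⟨hφ.contDiff.comp (contDiff_id.add contDiff_const),
    hφ.hasCompactSupport.comp_homeomorph (Homeomorph.addRight b), by simp⟩

omit [FiniteDimensional ℝ E] [MeasurableSpace E] [BorelSpace E] in
/-- A translate of a divergence-free field is divergence free (local copy of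
`VectorCalculus.IsDivFree.comp_add_right` of `KatoSymmetryCovariance`, not imported here).
[folklore] -/
private theorem isDivFree_comp_add_right_aux {φ : E → E}
    (hφ : VectorCalculus.IsDivFree φ) (b : E) : VectorCalculus.IsDivFree fun x => φ (x + b) := by
  intro x
  have h := hφ (x + b)
  simp only [VectorCalculus.divergence] at h ⊢
  rwa [fderiv_comp_add_right]

/-- **Pairings with translates along `e` are constant when the `e`-derivatives of all
divergence-free tests are annihilated.** If `v` is bounded and measurable with
`∫⟪v, ∂ₑφ⟫ = 0` for every divergence-free test field `φ`, then `∫⟪v, φ(· − he)⟫ = ∫⟪v, φ⟫` for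
every such `φ` and every `h` (the function `s ↦ ∫⟪v, φ(· − se)⟫` has derivative
`−∫⟪v, ∂ₑ[φ(· − se)]⟫ = 0`, the difference quotients of the test field converging in `L¹`,
`tendsto_integral_norm_slope_sub_fderiv`). [folklore] -/
theorem integral_inner_comp_sub_smul_eq_of_forall_fderiv {v : E → E}
    (hv : AEStronglyMeasurable v volume) {M : ℝ} (hM : ∀ x, ‖v x‖ ≤ M) {e : E}
    (h0 : ∀ φ : E → E, FunctionSpaces.IsTestFunctionOn (⊤ : Opens E) φ → VectorCalculus.IsDivFree φ →
      ∫ x, ⟪v x, fderiv ℝ φ x e⟫ = 0)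
    {φ : E → E} (hφ : FunctionSpaces.IsTestFunctionOn (⊤ : Opens E) φ) (hdiv : VectorCalculus.IsDivFree φ)
    (h : ℝ) : ∫ x, ⟪v x, φ (x - h • e)⟫ = ∫ x, ⟪v x, φ x⟫ := by
  have hM0 : 0 ≤ M := (norm_nonneg _).trans (hM 0)
  set F : ℝ → ℝ := fun s => ∫ x, ⟪v x, φ (x - s • e)⟫ with hF
  -- `F` has derivative zero everywhere
  have hderiv : ∀ s, HasDerivAt F 0 s := by
    intro s
    -- the translate `φₛ = φ(· - s e)` is a divergence-free test field
    set φs : E → E := fun x => φ (x - s • e) with hφs_def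
    have hφs : FunctionSpaces.IsTestFunctionOn (⊤ : Opens E) φs := by
      simpa only [hφs_def, sub_eq_add_neg] using hφ.comp_add_right' (-(s • e))
    have hdivs : VectorCalculus.IsDivFree φs := by
      simpa only [hφs_def, sub_eq_add_neg] using isDivFree_comp_add_right_aux hdiv (-(s • e))
    have hφs1 : ContDiff ℝ 1 φs := hφs.contDiff.of_le (by exact_mod_cast le_top)
    have hφsi : Integrable φs := hφs.contDiff.continuous.integrable_of_hasCompactSupport hφs.hasCompactSupport
    -- difference quotients of `F` are pairings with difference quotients of `φₛ` along `-e`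
    have hslope : ∀ k : ℝ, k ≠ 0 → k⁻¹ * (F (s + k) - F s) =
        ∫ x, ⟪v x, k⁻¹ • (φs (x + k • (-e)) - φs x)⟫ := by
      intro k hk
      have i1 : Integrable fun x => ⟪v x, φs (x + k • (-e))⟫ :=
        integrable_inner_of_aestronglyMeasurable_of_norm_le hv hM (hφsi.comp_add_right _)
      have i2 : Integrable fun x => ⟪v x, φs x⟫ :=
        integrable_inner_of_aestronglyMeasurable_of_norm_le hv hM hφsi
      have e1 : F (s + k) = ∫ x, ⟪v x, φs (x + k • (-e))⟫ := by
        simp only [hF]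
        refine integral_congr_ae (Eventually.of_forall fun x => ?_)
        simp only [hφs_def, smul_neg, add_smul]
        congr 2
        abel
      have e2 : F s = ∫ x, ⟪v x, φs x⟫ := rfl
      rw [e1, e2, ← integral_sub i1 i2, ← integral_const_mul]
      refine integral_congr_ae (Eventually.of_forall fun x => ?_)
      simp only [real_inner_smul_right, inner_sub_right]
    -- the limit pairing vanishes
    have hlim0 : ∫ x, ⟪v x, fderiv ℝ φs x (-e)⟫ = 0 := by
      simp_rw [map_neg, inner_neg_right, integral_neg]
      rw [h0 φs hφs hdivs, neg_zero]
    -- estimate `|k⁻¹ (F(s+k) - F(s)) - 0| ≤ M ∫ ‖q_k - ∂_{-e} φₛ‖`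
    have hest : ∀ k : ℝ, k ≠ 0 → ‖k⁻¹ * (F (s + k) - F s)‖ ≤
        M * ∫ x, ‖k⁻¹ • (φs (x + k • (-e)) - φs x) - fderiv ℝ φs x (-e)‖ := by
      intro k hk
      have hDi : Integrable fun x => fderiv ℝ φs x (-e) :=
        ((hφs1.continuous_fderiv one_ne_zero).clm_apply continuous_const).integrable_of_hasCompactSupport
          (hφs.hasCompactSupport.fderiv_apply (𝕜 := ℝ) (-e))
      have hqi : Integrable fun x => k⁻¹ • (φs (x + k • (-e)) - φs x) :=
        ((hφsi.comp_add_right _).sub hφsi).smul k⁻¹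
      have i3 : Integrable fun x => ⟪v x, k⁻¹ • (φs (x + k • (-e)) - φs x)⟫ :=
        integrable_inner_of_aestronglyMeasurable_of_norm_le hv hM hqi
      have i4 : Integrable fun x => ⟪v x, fderiv ℝ φs x (-e)⟫ :=
        integrable_inner_of_aestronglyMeasurable_of_norm_le hv hM hDi
      have hrepr : k⁻¹ * (F (s + k) - F s) =
          ∫ x, (⟪v x, k⁻¹ • (φs (x + k • (-e)) - φs x)⟫ - ⟪v x, fderiv ℝ φs x (-e)⟫) := by
        rw [integral_sub i3 i4, hlim0, sub_zero, hslope k hk]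
      rw [hrepr]
      calc ‖∫ x, (⟪v x, k⁻¹ • (φs (x + k • (-e)) - φs x)⟫ - ⟪v x, fderiv ℝ φs x (-e)⟫)‖
          ≤ ∫ x, M * ‖k⁻¹ • (φs (x + k • (-e)) - φs x) - fderiv ℝ φs x (-e)‖ :=
            norm_integral_le_of_norm_le ((hqi.sub hDi).norm.const_mul M) (Eventually.of_forall fun x => by
              rw [← inner_sub_right]
              exact (norm_inner_le_norm _ _).trans (mul_le_mul_of_nonneg_right (hM x) (norm_nonneg _)))
        _ = M * ∫ x, ‖k⁻¹ • (φs (x + k • (-e)) - φs x) - fderiv ℝ φs x (-e)‖ := integral_const_mul _ _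
    have htend : Tendsto (fun k : ℝ => M * ∫ x, ‖k⁻¹ • (φs (x + k • (-e)) - φs x) - fderiv ℝ φs x (-e)‖)
        (𝓝[≠] 0) (𝓝 0) := by
      simpa using (tendsto_integral_norm_slope_sub_fderiv hφs1 hφs.hasCompactSupport (-e)).const_mul M
    rw [hasDerivAt_iff_tendsto_slope_zero]
    refine squeeze_zero_norm' ?_ htend
    filter_upwards [self_mem_nhdsWithin] with k hk
    simpa only [smul_eq_mul] using hest k hk
  have hconst := is_const_of_deriv_eq_zero (fun s => (hderiv s).differentiableAt) (fun s => (hderiv s).deriv) h 0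
  simpa [hF] using hconst

/-- **Iterated a.e.-constant increments are unbounded unless zero**: if `v(· + b) − v = κ` a.e.
for a bounded `v`, then `κ = 0` (`v(· + n b) − v = n κ` a.e. by induction, and `‖n κ‖ ≤ 2M`).
[folklore] -/
theorem eq_zero_of_ae_comp_add_sub_eq_const {v : E → E} {M : ℝ} (hM : ∀ x, ‖v x‖ ≤ M) {b κ : E}
    (h : (fun x => v (x + b) - v x) =ᵐ[volume] fun _ => κ) : κ = 0 := by
  have hM0 : 0 ≤ M := (norm_nonneg _).trans (hM 0)
  -- `v(x + n b) - v x = n κ` a.e.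
  have hiter : ∀ n : ℕ, (fun x => v (x + (n : ℝ) • b) - v x) =ᵐ[volume] fun _ => (n : ℝ) • κ := by
    intro n
    induction n with
    | zero => exact Eventually.of_forall fun x => by simp
    | succ n ih =>
      have ih' : (fun x => v (x + b + (n : ℝ) • b) - v (x + b)) =ᵐ[volume] fun _ => (n : ℝ) • κ :=
        (measurePreserving_add_right volume b).quasiMeasurePreserving.ae_eq ih
      filter_upwards [ih', h] with x hx hx'
      have e1 : x + ((n : ℝ) + 1) • b = x + b + (n : ℝ) • b := by rw [add_smul, one_smul]; abel
      simp only [Nat.cast_succ, e1]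
      calc v (x + b + (n : ℝ) • b) - v x = (v (x + b + (n : ℝ) • b) - v (x + b)) + (v (x + b) - v x) := by abel
        _ = (n : ℝ) • κ + κ := by rw [hx, hx']
        _ = ((n : ℝ) + 1) • κ := by rw [add_smul, one_smul]
  -- `‖n κ‖ ≤ 2M` for all `n`
  have hbd : ∀ n : ℕ, (n : ℝ) * ‖κ‖ ≤ 2 * M := by
    intro n
    obtain ⟨x, hx⟩ := (hiter n).exists
    have hx' : v (x + (n : ℝ) • b) - v x = (n : ℝ) • κ := hx
    have : ‖(n : ℝ) • κ‖ ≤ 2 * M := by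
      rw [← hx']
      exact (norm_sub_le _ _).trans (by linarith [hM (x + (n : ℝ) • b), hM x])
    rwa [norm_smul, Real.norm_of_nonneg (Nat.cast_nonneg n)] at this
  by_contra hκ
  have hκ' : 0 < ‖κ‖ := norm_pos_iff.2 hκ
  obtain ⟨n, hn⟩ := exists_nat_gt (2 * M / ‖κ‖)
  have := hbd n
  rw [div_lt_iff₀ hκ'] at hn
  linarith

/-- **A bounded, measurable, weakly divergence-free field annihilating the `e`-derivatives of
all divergence-free test fields is a.e. invariant under the translations along `e`.** For each
`h`, `v(· + he) − v` is bounded, measurable, weakly divergence free and annihilates the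
divergence-free tests (`integral_inner_comp_sub_smul_eq_of_forall_fderiv`), hence is a.e. a
constant (the `L^∞` annihilator lemma), which must vanish
(`eq_zero_of_ae_comp_add_sub_eq_const`). [folklore] -/
theorem ae_eq_comp_add_smul_of_forall_integral_inner_fderiv_eq_zero {v : E → E}
    (hv : AEStronglyMeasurable v volume) {M : ℝ} (hM : ∀ x, ‖v x‖ ≤ M) (hdiv : IsWeaklyDivFree v) {e : E}
    (h0 : ∀ φ : E → E, FunctionSpaces.IsTestFunctionOn (⊤ : Opens E) φ → VectorCalculus.IsDivFree φ →
      ∫ x, ⟪v x, fderiv ℝ φ x e⟫ = 0) (h : ℝ) :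
    (fun x => v (x + h • e)) =ᵐ[volume] v := by
  set g : E → E := fun x => v (x + h • e) - v x with hg
  have hvt : AEStronglyMeasurable (fun x => v (x + h • e)) volume :=
    hv.comp_quasiMeasurePreserving (measurePreserving_add_right volume (h • e)).quasiMeasurePreserving
  have hgm : AEStronglyMeasurable g volume := hvt.sub hv
  have hgb : ∀ x, ‖g x‖ ≤ M + M := fun x => (norm_sub_le _ _).trans (add_le_add (hM _) (hM _))
  have hgdiv : IsWeaklyDivFree g := by
    intro θ hθ
    have hgi : Integrable (gradient θ) := by
      haveI : CompleteSpace E := FiniteDimensional.complete ℝ E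
      have hθ1 : ContDiff ℝ 1 θ := hθ.contDiff.of_le (by exact_mod_cast le_top)
      exact ((InnerProductSpace.toDual ℝ E).symm.continuous.comp (hθ1.continuous_fderiv one_ne_zero)).integrable_of_hasCompactSupport
        ((hθ.hasCompactSupport.fderiv ℝ).comp_left (g := fun L => (InnerProductSpace.toDual ℝ E).symm L) (map_zero _))
    have i1 : Integrable fun x => ⟪v (x + h • e), gradient θ x⟫ :=
      integrable_inner_of_aestronglyMeasurable_of_norm_le hvt (fun x => hM _) hgi
    have i2 : Integrable fun x => ⟪v x, gradient θ x⟫ :=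
      integrable_inner_of_aestronglyMeasurable_of_norm_le hv hM hgi
    show ∫ x, ⟪v (x + h • e) - v x, gradient θ x⟫ = 0
    simp_rw [inner_sub_left]
    rw [integral_sub i1 i2, (hdiv.comp_add_right' (h • e)) θ hθ, hdiv θ hθ, sub_zero]
  have horth : ∀ φ : E → E, FunctionSpaces.IsTestFunctionOn (⊤ : Opens E) φ → VectorCalculus.IsDivFree φ →
      ∫ x, ⟪g x, φ x⟫ = 0 := by
    intro φ hφ hdivφ
    have hφi : Integrable φ := hφ.contDiff.continuous.integrable_of_hasCompactSupport hφ.hasCompactSupport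
    have i1 : Integrable fun x => ⟪v (x + h • e), φ x⟫ :=
      integrable_inner_of_aestronglyMeasurable_of_norm_le hvt (fun x => hM _) hφi
    have i2 : Integrable fun x => ⟪v x, φ x⟫ := integrable_inner_of_aestronglyMeasurable_of_norm_le hv hM hφi
    -- `∫⟪v(x + he), φ x⟫ = ∫⟪v x, φ(x - he)⟫`
    have hshift : ∫ x, ⟪v (x + h • e), φ x⟫ = ∫ x, ⟪v x, φ (x - h • e)⟫ := by
      have := integral_add_right_eq_self (μ := volume) (fun x => ⟪v x, φ (x - h • e)⟫) (h • e)
      simp only [add_sub_cancel_right] at this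
      exact this
    show ∫ x, ⟪v (x + h • e) - v x, φ x⟫ = 0
    simp_rw [inner_sub_left]
    rw [integral_sub i1 i2, hshift, integral_inner_comp_sub_smul_eq_of_forall_fderiv hv hM h0 hφ hdivφ h,
      sub_self]
  obtain ⟨κ, hκ⟩ := IsWeaklyDivFree.exists_ae_eq_const_of_norm_le_of_forall_integral_inner_eq_zero hgm hgb
    hgdiv horth
  have hκ0 : κ = 0 := eq_zero_of_ae_comp_add_sub_eq_const hM hκ
  rw [hκ0] at hκ
  filter_upwards [hκ] with x hx
  exact sub_eq_zero.1 hx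

end Invariance

/-! ### From the caloric level at vanishing times and a dense family to the test fields -/

section Caloric

/-- **`L¹` gradient smoothing of the caloric extension, integral form**: there is `C ≥ 0` with
`∫ ‖D(e^{σΔ}f)(x) b‖ dx ≤ C σ^{-1/2} ‖b‖ ∫‖f‖` for every `C¹` compactly supported field `f`,
every vector `b` and every `σ > 0`
(`Literature.Analysis.UnboundedOperators.eLpNorm_fderiv_heatExtension_le`, `p = 1`). [folklore] -/
theorem exists_integral_norm_fderiv_heatExtension_apply_le :
    ∃ C : ℝ, 0 ≤ C ∧ ∀ {f : E → E}, ContDiff ℝ 1 f → HasCompactSupport f → ∀ (b : E) {σ : ℝ}, 0 < σ →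
      ∫ x, ‖fderiv ℝ (UnboundedOperators.heatExtension f σ) x b‖ ≤ C * σ ^ (-(1 / 2 : ℝ)) * ‖b‖ * ∫ x, ‖f x‖ := by
  obtain ⟨C, hC⟩ := UnboundedOperators.eLpNorm_fderiv_heatExtension_le_holds (E := E) (F := E) (p := 1) le_rfl
  refine ⟨C, C.2, fun {f} hf hc b σ hσ => ?_⟩
  have hfc : Continuous f := hf.continuous
  have hfi : Integrable f := hfc.integrable_of_hasCompactSupport hc
  have hfp : MemLp f 1 (volume : Measure E) := memLp_one_iff_integrable.2 hfi
  have hfin : eLpNorm f 1 (volume : Measure E) < ⊤ := hfp.eLpNorm_lt_top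
  have hDc : Continuous (fderiv ℝ f) := hf.continuous_fderiv one_ne_zero
  have hDi : Integrable (UnboundedOperators.heatExtension (fderiv ℝ f) σ) :=
    UnboundedOperators.integrable_heatExtension (hDc.integrable_of_hasCompactSupport (hc.fderiv ℝ)) hσ
  have hDeq : fderiv ℝ (UnboundedOperators.heatExtension f σ) = UnboundedOperators.heatExtension (fderiv ℝ f) σ :=
    funext fun x => UnboundedOperators.fderiv_heatExtension_of_hasCompactSupport hf hc σ x
  have hDi' : Integrable (fderiv ℝ (UnboundedOperators.heatExtension f σ)) volume := by rw [hDeq]; exact hDi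
  have hL1 : (eLpNorm f 1 (volume : Measure E)).toReal = ∫ x, ‖f x‖ := by
    rw [integral_norm_eq_lintegral_enorm hfi.aestronglyMeasurable, eLpNorm_one_eq_lintegral_enorm]
  have hbound : ∫ x, ‖fderiv ℝ (UnboundedOperators.heatExtension f σ) x‖ ≤
      C * σ ^ (-(1 / 2 : ℝ)) * ∫ x, ‖f x‖ := by
    rw [integral_norm_eq_lintegral_enorm hDi'.aestronglyMeasurable, ← eLpNorm_one_eq_lintegral_enorm, ← hL1]
    have h := hC f hfp σ hσ
    have hfin' : (C : ℝ≥0∞) * ENNReal.ofReal (σ ^ (-(1 / 2 : ℝ))) * eLpNorm f 1 volume ≠ ⊤ :=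
      ENNReal.mul_ne_top (ENNReal.mul_ne_top ENNReal.coe_ne_top ENNReal.ofReal_ne_top) hfin.ne
    refine (ENNReal.toReal_mono hfin' h).trans_eq ?_
    rw [ENNReal.toReal_mul, ENNReal.toReal_mul, ENNReal.coe_toReal,
      ENNReal.toReal_ofReal (Real.rpow_nonneg hσ.le _)]
  calc ∫ x, ‖fderiv ℝ (UnboundedOperators.heatExtension f σ) x b‖
      ≤ ∫ x, ‖b‖ * ‖fderiv ℝ (UnboundedOperators.heatExtension f σ) x‖ := by
        refine integral_mono_of_nonneg (Eventually.of_forall fun _ => norm_nonneg _)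
          (hDi'.norm.const_mul _) (Eventually.of_forall fun x => ?_)
        show ‖fderiv ℝ (UnboundedOperators.heatExtension f σ) x b‖ ≤ ‖b‖ * ‖fderiv ℝ (UnboundedOperators.heatExtension f σ) x‖
        rw [mul_comm]
        exact (fderiv ℝ (UnboundedOperators.heatExtension f σ) x).le_opNorm b
    _ = ‖b‖ * ∫ x, ‖fderiv ℝ (UnboundedOperators.heatExtension f σ) x‖ := integral_const_mul _ _
    _ ≤ ‖b‖ * (C * σ ^ (-(1 / 2 : ℝ)) * ∫ x, ‖f x‖) := mul_le_mul_of_nonneg_left hbound (norm_nonneg _)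
    _ = C * σ ^ (-(1 / 2 : ℝ)) * ‖b‖ * ∫ x, ‖f x‖ := by ring

/-- **Vanishing at the caloric level passes from a dense family to all tests, at a fixed positive
time**: if a bounded measurable `v` satisfies `∫⟪v, ∂ₑ e^{νσΔ}φₖ⟫ = 0` for an `L¹`-dense family
`φₖ` of divergence-free tests and some `σ > 0`, then `∫⟪v, ∂ₑ e^{νσΔ}ψ⟫ = 0` for every
divergence-free test `ψ` (`|∫⟪v, ∂ₑe^{νσΔ}(ψ − φₖ)⟫| ≤ M C (νσ)^{-1/2}‖e‖ ‖ψ − φₖ‖₁`). [folklore] -/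
theorem integral_inner_fderiv_heatTest_eq_zero_of_dense {v : E → E}
    (hv : AEStronglyMeasurable v volume) {M : ℝ} (hM : ∀ x, ‖v x‖ ≤ M) {e : E}
    {φs : ℕ → E → E} (hφs : ∀ k, FunctionSpaces.IsTestFunctionOn (⊤ : Opens E) (φs k) ∧ VectorCalculus.IsDivFree (φs k))
    (hdense : ∀ ψ : E → E, FunctionSpaces.IsTestFunctionOn (⊤ : Opens E) ψ → VectorCalculus.IsDivFree ψ →
      ∀ ε > 0, ∃ k, ∫ x, ‖ψ x - φs k x‖ < ε)
    {ν σ : ℝ} (hνσ : 0 < ν * σ) (hzero : ∀ k, ∫ x, ⟪v x, fderiv ℝ (heatTest ν (φs k) σ) x e⟫ = 0)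
    {ψ : E → E} (hψ : FunctionSpaces.IsTestFunctionOn (⊤ : Opens E) ψ) (hψdiv : VectorCalculus.IsDivFree ψ) :
    ∫ x, ⟪v x, fderiv ℝ (heatTest ν ψ σ) x e⟫ = 0 := by
  have hM0 : 0 ≤ M := (norm_nonneg _).trans (hM 0)
  obtain ⟨C, hC0, hC⟩ := exists_integral_norm_fderiv_heatExtension_apply_le (E := E)
  set s := ν * σ with hs
  set A : ℝ := ∫ x, ⟪v x, fderiv ℝ (heatTest ν ψ σ) x e⟫ with hA
  -- `|A| ≤ M C s^{-1/2} ‖e‖ ∫‖ψ - φₖ‖` for every `k`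
  have hest : ∀ k, ‖A‖ ≤ M * (C * s ^ (-(1 / 2 : ℝ)) * ‖e‖) * ∫ x, ‖ψ x - φs k x‖ := by
    intro k
    have hψ1 : ContDiff ℝ 1 ψ := hψ.contDiff.of_le (by exact_mod_cast le_top)
    have hφ1 : ContDiff ℝ 1 (φs k) := (hφs k).1.contDiff.of_le (by exact_mod_cast le_top)
    set f : E → E := fun x => ψ x - φs k x with hf
    have hf1 : ContDiff ℝ 1 f := hψ1.sub hφ1
    have hfc : HasCompactSupport f := hψ.hasCompactSupport.sub (hφs k).1.hasCompactSupport
    obtain ⟨Cψ, hCψ⟩ := hψ.exists_norm_le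
    obtain ⟨Cφ, hCφ⟩ := (hφs k).1.exists_norm_le
    -- `∂ₑ e^{sΔ}ψ - ∂ₑ e^{sΔ}φₖ = ∂ₑ e^{sΔ}(ψ - φₖ)`
    have hdψ : Differentiable ℝ (heatTest ν ψ σ) :=
      (contDiff_heatFlow hψ1 hψ.hasCompactSupport _).differentiable one_ne_zero
    have hdφ : Differentiable ℝ (heatTest ν (φs k) σ) :=
      (contDiff_heatFlow hφ1 (hφs k).1.hasCompactSupport _).differentiable one_ne_zero
    have hflow : heatTest ν f σ = fun x => heatTest ν ψ σ x - heatTest ν (φs k) σ x :=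
      funext fun x => heatFlow_sub_of_bound hψ.contDiff.continuous (hφs k).1.contDiff.continuous hCψ hCφ _ x
    have hDf : ∀ x, fderiv ℝ (heatTest ν f σ) x e =
        fderiv ℝ (heatTest ν ψ σ) x e - fderiv ℝ (heatTest ν (φs k) σ) x e := fun x => by
      rw [hflow, fderiv_fun_sub (hdψ x) (hdφ x)]
      rfl
    -- integrability of the two pairings
    have hint : ∀ {g : E → E}, ContDiff ℝ 1 g → HasCompactSupport g →
        Integrable fun x => fderiv ℝ (heatTest ν g σ) x e := by
      intro g hg hgc
      have hgec : Continuous fun z => fderiv ℝ g z e := (hg.continuous_fderiv one_ne_zero).clm_apply continuous_const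
      have : Integrable (heatFlow (fun z => fderiv ℝ g z e) (ν * σ)) :=
        integrable_heatFlow (hgec.integrable_of_hasCompactSupport (hgc.fderiv_apply (𝕜 := ℝ) e)) _
      exact this.congr (Eventually.of_forall fun x => (fderiv_heatFlow_apply hg hgc _ x e).symm)
    have i1 := integrable_inner_of_aestronglyMeasurable_of_norm_le hv hM (hint hψ1 hψ.hasCompactSupport)
    have i2 := integrable_inner_of_aestronglyMeasurable_of_norm_le hv hM (hint hφ1 (hφs k).1.hasCompactSupport)
    have hAf : A = ∫ x, ⟪v x, fderiv ℝ (heatTest ν f σ) x e⟫ := by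
      rw [hA, ← sub_zero (∫ x, ⟪v x, fderiv ℝ (heatTest ν ψ σ) x e⟫), ← hzero k, ← integral_sub i1 i2]
      exact integral_congr_ae (Eventually.of_forall fun x => by simp only [hDf x, inner_sub_right])
    have hfi' := hint hf1 hfc
    have hext : ∀ x, fderiv ℝ (heatTest ν f σ) x e = fderiv ℝ (UnboundedOperators.heatExtension f s) x e := by
      intro x
      rw [show heatTest ν f σ = heatFlow f (ν * σ) from rfl, heatFlow_of_pos _ hνσ]
    rw [hAf]
    calc ‖∫ x, ⟪v x, fderiv ℝ (heatTest ν f σ) x e⟫‖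
        ≤ ∫ x, M * ‖fderiv ℝ (heatTest ν f σ) x e‖ :=
          norm_integral_le_of_norm_le (hfi'.norm.const_mul M) (Eventually.of_forall fun x =>
            (norm_inner_le_norm _ _).trans (mul_le_mul_of_nonneg_right (hM x) (norm_nonneg _)))
      _ = M * ∫ x, ‖fderiv ℝ (UnboundedOperators.heatExtension f s) x e‖ := by
          rw [integral_const_mul]
          simp_rw [hext]
      _ ≤ M * (C * s ^ (-(1 / 2 : ℝ)) * ‖e‖ * ∫ x, ‖f x‖) :=
          mul_le_mul_of_nonneg_left (hC hf1 hfc e hνσ) hM0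
      _ = M * (C * s ^ (-(1 / 2 : ℝ)) * ‖e‖) * ∫ x, ‖ψ x - φs k x‖ := by rw [hf]; ring
  -- choose `k` with `∫‖ψ - φₖ‖` small
  have hK0 : 0 ≤ M * (C * s ^ (-(1 / 2 : ℝ)) * ‖e‖) := by positivity
  refine norm_le_zero_iff.1 (le_of_forall_pos_le_add fun ε hε => ?_)
  rw [zero_add]
  obtain ⟨k, hk⟩ := hdense ψ hψ hψdiv (ε / (M * (C * s ^ (-(1 / 2 : ℝ)) * ‖e‖) + 1)) (by positivity)
  calc ‖A‖ ≤ M * (C * s ^ (-(1 / 2 : ℝ)) * ‖e‖) * ∫ x, ‖ψ x - φs k x‖ := hest k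
    _ ≤ (M * (C * s ^ (-(1 / 2 : ℝ)) * ‖e‖) + 1) * ∫ x, ‖ψ x - φs k x‖ :=
        mul_le_mul_of_nonneg_right (le_add_of_nonneg_right zero_le_one) (integral_nonneg fun _ => norm_nonneg _)
    _ ≤ (M * (C * s ^ (-(1 / 2 : ℝ)) * ‖e‖) + 1) * (ε / (M * (C * s ^ (-(1 / 2 : ℝ)) * ‖e‖) + 1)) :=
        mul_le_mul_of_nonneg_left hk.le (by positivity)
    _ = ε := by field_simp

/-- **Vanishing at the caloric level along times tending to zero descends to the test field**:
if `∫⟪v, ∂ₑ e^{νσₙΔ}ψ⟫ = 0` along `σₙ → 0⁺` then `∫⟪v, ∂ₑψ⟫ = 0`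
(`∂ₑe^{νσΔ}ψ = e^{νσΔ}∂ₑψ → ∂ₑψ` against bounded fields, the caloric pairing increment being
`O(σ)`, `norm_integral_inner_heatTest_sub_le_of_norm_le`). [folklore] -/
theorem integral_inner_fderiv_eq_zero_of_tendsto {v : E → E}
    (hv : AEStronglyMeasurable v volume) {M : ℝ} (hM : ∀ x, ‖v x‖ ≤ M) {e : E}
    {ν : ℝ} (hν : 0 < ν) {σ : ℕ → ℝ} (hσpos : ∀ n, 0 < σ n) (hσ : Tendsto σ atTop (𝓝 0))
    {ψ : E → E} (hψ : FunctionSpaces.IsTestFunctionOn (⊤ : Opens E) ψ)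
    (hzero : ∀ n, ∫ x, ⟪v x, fderiv ℝ (heatTest ν ψ (σ n)) x e⟫ = 0) :
    ∫ x, ⟪v x, fderiv ℝ ψ x e⟫ = 0 := by
  have hM0 : 0 ≤ M := (norm_nonneg _).trans (hM 0)
  have hψ1 : ContDiff ℝ 1 ψ := hψ.contDiff.of_le (by exact_mod_cast le_top)
  -- the test field `ψₑ = ∂ₑψ`
  set ψe : E → E := fun z => fderiv ℝ ψ z e with hψe
  have hψet : FunctionSpaces.IsTestFunctionOn (⊤ : Opens E) ψe := hψ.fderiv_apply_const e
  have hψe2 : ContDiff ℝ 2 ψe := contDiff_infty.1 hψet.contDiff 2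
  have hflow : ∀ n x, fderiv ℝ (heatTest ν ψ (σ n)) x e = heatTest ν ψe (σ n) x := fun n x =>
    fderiv_heatFlow_apply hψ1 hψ.hasCompactSupport _ x e
  -- `|∫⟪v, ψₑ⟫ - ∫⟪v, e^{νσₙΔ}ψₑ⟫| ≤ σₙ ν M ‖Δψₑ‖₁`
  have hest : ∀ n, ‖∫ x, ⟪v x, ψe x⟫‖ ≤ σ n * (ν * (M * ∫ x, ‖(Δ ψe) x‖)) := by
    intro n
    have h := norm_integral_inner_heatTest_sub_le_of_norm_le hv hM hψe2 hψet.hasCompactSupport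
      (t := σ n) (σ₁ := 0) (σ₂ := σ n) hν (hσpos n).le le_rfl
    have h0 : ∫ x, ⟪v x, heatTest ν ψe (σ n - 0) x⟫ = 0 := by
      rw [sub_zero]
      simpa only [hflow] using hzero n
    rwa [sub_self, heatTest_zero_right, h0, sub_zero, sub_zero] at h
  have htend : Tendsto (fun n => σ n * (ν * (M * ∫ x, ‖(Δ ψe) x‖))) atTop (𝓝 0) := by
    simpa using hσ.mul_const (ν * (M * ∫ x, ‖(Δ ψe) x‖))
  have hle : ‖∫ x, ⟪v x, ψe x⟫‖ ≤ 0 := ge_of_tendsto htend (Eventually.of_forall hest)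
  exact norm_le_zero_iff.1 hle

end Caloric


/-! ### `ℝ³`: the slice-wise Theorem 5.2 from the theorem in print -/

section Bridge

/-- A field a.e. equal to a weakly divergence-free field shifted by a constant is weakly divergence
free. [folklore] -/
theorem isWeaklyDivFree_of_ae_eq_add_const {v u : E → E} (hu : IsWeaklyDivFree u)
    (hum : AEStronglyMeasurable u volume) {M : ℝ} (hM : ∀ x, ‖u x‖ ≤ M) (κ : E)
    (h : v =ᵐ[volume] fun x => u x + κ) : IsWeaklyDivFree v := by
  haveI : CompleteSpace E := FiniteDimensional.complete ℝ E
  intro θ hθ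
  have hθ1 : ContDiff ℝ 1 θ := hθ.contDiff.of_le (by exact_mod_cast le_top)
  have hgi : Integrable (gradient θ) :=
    ((InnerProductSpace.toDual ℝ E).symm.continuous.comp (hθ1.continuous_fderiv one_ne_zero)).integrable_of_hasCompactSupport
      ((hθ.hasCompactSupport.fderiv ℝ).comp_left (g := fun L => (InnerProductSpace.toDual ℝ E).symm L) (map_zero _))
  have i1 : Integrable fun x => ⟪u x, gradient θ x⟫ := integrable_inner_of_aestronglyMeasurable_of_norm_le hum hM hgi
  have i2 : Integrable fun x => ⟪κ, gradient θ x⟫ := hgi.const_inner _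
  calc ∫ x, ⟪v x, gradient θ x⟫ = ∫ x, (⟪u x, gradient θ x⟫ + ⟪κ, gradient θ x⟫) :=
        integral_congr_ae (by filter_upwards [h] with x hx; rw [hx, inner_add_left])
    _ = 0 := by
        rw [integral_add i1 i2, hu θ hθ, (VectorCalculus.IsDivFree.isWeaklyDivFree_holds (u := fun _ : E => κ)
          (fun x => by simp [VectorCalculus.divergence]) contDiff_const) θ hθ, add_zero]

/-- **KNSS 2009, Theorem 5.2: the slice-wise fact `knss_axisymmetric_no_swirl` follows from the
theorem in print.** Assume Theorem 5.2 for KNSS's bounded weak solutions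
(`KNSS2009_liouville_axisymmetric_no_swirl`: an `L^∞(ℝ³ × (−∞, 0))` weak solution, axisymmetric
and swirl-free a.e., is `b(t) e_z` a.e. in `x` for a.e. `t < 0`). Then every bounded ancient mild
solution in the tree's duality form (`ν = 1`) with measurable *slices* (no joint measurability),
pointwise axisymmetric and swirl-free at every `t < 0`, has every slice a.e. equal to some
`β e_z`. **Proof** (the reduction of the slice-wise class to print's `L^∞(ℝ³ × (−∞, 0))`, KNSS
2009, §1 p. 3 and §3 p. 7: in print the spatial constant `b(t)` of a bounded weak solution is
bounded *measurable*; in the duality-form class it need not be, and the steps below show that this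
is the only obstruction and that it is harmless). (1) Subtracting the axial average
`c(t) e_z = ∫ g u(t)` against a radial weight leaves a family with a jointly measurable bounded
modification `w`, `u(t) = w(t) + c(t)e_z` a.e. (`exists_modification_sub_average`,
`integral_smul_eq_smul_eZ_of_isAxisymmetric`); the nonlinear time integrand of the identity ending
at `q` splits as `N(τ) + c(τ) m_φ(τ)` with `N`, `m_φ` measurable
(`integral_inner_convect_heatTest_add_const`). (2) At a rational final time `q` whose slice is not
a.e. constant every nonlinear integrand is honestly integrable
(`intervalIntegrable_nonlinear_of_not_ae_const`), so `c m_φ` and hence `c` is a.e. measurable on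
`{m_{φₖ}^q ≠ 0}` for a countable `L¹`-dense family `φₖ` of solenoidal tests
(`exists_seq_isDivFree_dense`); let `𝒢` be the union of these sets and `c̃` a bounded measurable
function with `c̃ = c` a.e. on `𝒢`, `c̃ = 0` off `𝒢`. (3) At every `τ ∉ 𝒢` the slice `u(τ)` is
invariant under the vertical translations: either the non-constant rational slices accumulate at
`τ⁺`, and then `∫⟪u τ, ∂_z e^{σₙΔ}φₖ⟫ = 0` along `σₙ → 0⁺` for all `k`, whence
`∫⟪u τ, ∂_zφ⟫ = 0` for every solenoidal test (`integral_inner_fderiv_heatTest_eq_zero_of_dense`,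
`integral_inner_fderiv_eq_zero_of_tendsto`) and invariance
(`ae_eq_comp_add_smul_of_forall_integral_inner_fderiv_eq_zero`); or the a.e.-constant slices
accumulate at `τ⁺` and `u(τ)` is itself a.e. constant by the continuity of the solenoidal pairings.
(4) By the drift lemma (`IsBoundedAncientMildSolution.add_timeConst_smul_of_ae_invariant`) the
jointly measurable `ũ = w + c̃ e_z` is again a bounded ancient mild solution, hence a bounded weak
solution (`IsBoundedAncientMildSolution.isBoundedWeakNSSolutionOn`), axisymmetric and swirl-free
a.e.; the printed theorem makes its slices, hence those of `u`, a.e. constant for a.e. `t`, and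
the continuity of the solenoidal pairings upgrades this to every `t < 0`
(`IsBoundedAncientMildSolution.exists_ae_eq_const_slice`), the constant being axial
(`eq_smul_eZ_of_ae_eq_const_of_isAxisymmetric`). [cite: KochNadirashviliSereginSverak2009, Thm 5.2 (arXiv pp. 9–10) with §1 p. 3 and §3 p. 7 (the constant b(t))] -/
theorem knss_axisymmetric_no_swirl_of_KNSS2009 (h52 : KNSS2009_liouville_axisymmetric_no_swirl) :
    knss_axisymmetric_no_swirl := by
  intro u hu hmeas haxi hswirl
  obtain ⟨M, hM'⟩ := hu.2
  have hM : ∀ t < 0, ∀ x, ‖u t x‖ ≤ M := fun t ht x => hM' t ht x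
  have hM0 : 0 ≤ M := (norm_nonneg _).trans (hM (-1) (by norm_num) 0)
  have hν : (0 : ℝ) < 1 := one_pos
  -- (i) a radial weight and the axial average `c t e_z`
  obtain ⟨g, hg, hg0, hg1, hgrad⟩ := exists_radial_test_weight (E := EuclideanSpace ℝ (Fin 3))
  have hgc : Continuous g := hg.contDiff.continuous
  have hgi : Integrable g := hgc.integrable_of_hasCompactSupport hg.hasCompactSupport
  have hgrot : ∀ y, g (rotZ Real.pi y) = g y := fun y => hgrad _ _ (norm_rotZ _ _)
  set c : ℝ → ℝ := fun t => ∫ y, g y * u t y 2 with hc_def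
  have havg : ∀ t < 0, ∫ y, g y • u t y = c t • eZ := fun t ht =>
    integral_smul_eq_smul_eZ_of_isAxisymmetric hgi hgrot (haxi t ht) (hmeas t ht) (hM t ht)
  have hcb : ∀ t < 0, |c t| ≤ M := by
    intro t ht
    have hint : Integrable fun y => g y * u t y 2 :=
      Integrable.mono' (hgi.norm.mul_const M) (hgi.aestronglyMeasurable.mul
        ((EuclideanSpace.proj (2 : Fin 3)).continuous.comp_aestronglyMeasurable (hmeas t ht)))
        (Eventually.of_forall fun y => by
          rw [norm_mul]
          refine mul_le_mul_of_nonneg_left ?_ (norm_nonneg _)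
          exact (by simpa using PiLp.norm_apply_le (u t y) 2 : ‖u t y 2‖ ≤ ‖u t y‖).trans (hM t ht y))
    calc |c t| = ‖∫ y, g y * u t y 2‖ := (Real.norm_eq_abs _).symm
      _ ≤ ∫ y, ‖g y‖ * M := norm_integral_le_of_norm_le (hgi.norm.mul_const M) (Eventually.of_forall fun y => by
          rw [norm_mul]
          refine mul_le_mul_of_nonneg_left ?_ (norm_nonneg _)
          exact (by simpa using PiLp.norm_apply_le (u t y) 2 : ‖u t y 2‖ ≤ ‖u t y‖).trans (hM t ht y))
      _ = M := by
          rw [integral_mul_const]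
          have : ∫ y, ‖g y‖ = 1 := by
            rw [← hg1]
            exact integral_congr_ae (Eventually.of_forall fun y => Real.norm_of_nonneg (hg0 y))
          rw [this, one_mul]
  -- (ii) the jointly measurable modification `w`, `u t = w t + c t e_z` a.e.
  obtain ⟨w, hw, ⟨B, hwB⟩, hwu⟩ :=
    hu.exists_modification_sub_average hν hmeas hgc hg.hasCompactSupport hg1
  have hwu' : ∀ t < 0, w t =ᵐ[volume] fun x => u t x - c t • eZ := fun t ht =>
    (hwu t ht).trans (Eventually.of_forall fun x => by simp only [havg t ht])
  have huw : ∀ t < 0, u t =ᵐ[volume] fun x => w t x + c t • eZ := fun t ht => by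
    filter_upwards [hwu' t ht] with x hx
    rw [hx, sub_add_cancel]
  have hwm : ∀ t, AEStronglyMeasurable (w t) volume := fun t =>
    (hw.comp_measurable measurable_prodMk_left).aestronglyMeasurable
  have hwdiv : ∀ t < 0, IsWeaklyDivFree (w t) := fun t ht =>
    isWeaklyDivFree_of_ae_eq_add_const (hu.1.1 t ht) (hmeas t ht) (hM t ht) (-(c t • eZ))
      ((hwu' t ht).trans (Eventually.of_forall fun x => by simp only [sub_eq_add_neg]))
  -- (iii) `u' = w + c e_z`, a.e. equal to `u` slice-wise
  set u' : ℝ → EuclideanSpace ℝ (Fin 3) → EuclideanSpace ℝ (Fin 3) := fun t x => w t x + c t • eZ with hu'_def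
  have hu'u : ∀ t < 0, u' t =ᵐ[volume] u t := fun t ht => (huw t ht).symm
  have heZ : ‖(eZ : EuclideanSpace ℝ (Fin 3))‖ = 1 := by simp [eZ]
  have hu'M : ∀ t < 0, ∀ x, ‖u' t x‖ ≤ B + M := fun t ht x =>
    (norm_add_le _ _).trans (add_le_add (hwB t x) (by rw [norm_smul, heZ, mul_one, Real.norm_eq_abs]; exact hcb t ht))
  have hu'sol : IsBoundedAncientMildSolution 1 u' := hu.congr_ae_slice hu'u ⟨B + M, fun t ht x => hu'M t ht x⟩
  have hu'meas : ∀ t < 0, AEStronglyMeasurable (u' t) volume := fun t _ => (hwm t).add aestronglyMeasurable_const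
  -- (v) a countable dense family of solenoidal tests; the cross terms `m` and their zero sets
  obtain ⟨φs, hφs, hdense⟩ := exists_seq_isDivFree_dense (E := EuclideanSpace ℝ (Fin 3))
  have hm_meas : ∀ (q : ℝ) (k : ℕ), Measurable fun τ =>
      ∫ x, ⟪w τ x, fderiv ℝ (heatTest 1 (φs k) (q - τ)) x eZ⟫ := fun q k =>
    measurable_integral_inner_fderiv_heatTest_apply hw (hφs k).1 1 q eZ
  -- honest rational final times: non-constant slices
  set H : Set ℚ := {q | (q : ℝ) < 0 ∧ ∀ κ : EuclideanSpace ℝ (Fin 3), ¬ (u q =ᵐ[volume] fun _ => κ)} with hH_def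
  set A : ℚ → ℕ → Set ℝ := fun q k =>
    {τ | τ < q ∧ (∫ x, ⟪w τ x, fderiv ℝ (heatTest 1 (φs k) (q - τ)) x eZ⟫) ≠ 0} with hA_def
  have hAm : ∀ q k, MeasurableSet (A q k) := fun q k =>
    measurableSet_Iio.inter ((hm_meas q k) (measurableSet_singleton (0 : ℝ)).compl)
  set Gd : Set ℝ := ⋃ p : H × ℕ, A p.1 p.2 with hGd_def
  have hGm : MeasurableSet Gd := MeasurableSet.iUnion fun p => hAm _ _
  have hGd0 : Gd ⊆ Iio 0 := by
    intro τ hτ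
    obtain ⟨p, hp⟩ := mem_iUnion.1 hτ
    exact lt_trans hp.1 p.1.2.1
  -- (iv)+(vii) `c` is a.e. measurable on `Gd`
  have hcA : ∀ (q : H) (k : ℕ), AEMeasurable c (volume.restrict (A q k)) := by
    intro q k
    have hq0 : ((q : ℚ) : ℝ) < 0 := q.2.1
    set qr : ℝ := ((q : ℚ) : ℝ) with hqr
    -- the three functions of `τ`
    set Gf : ℝ → ℝ := fun τ => ∫ x, ⟪u τ x, convect (u τ) (heatTest 1 (φs k) (qr - τ)) x⟫ with hGf
    set Nf : ℝ → ℝ := fun τ => ∫ x, ⟪w τ x, fderiv ℝ (heatTest 1 (φs k) (qr - τ)) x (w τ x)⟫ with hNf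
    set mf : ℝ → ℝ := fun τ => ∫ x, ⟪w τ x, fderiv ℝ (heatTest 1 (φs k) (qr - τ)) x eZ⟫ with hmf
    have hNm : Measurable Nf := measurable_integral_inner_fderiv_heatTest_self hw (hφs k).1 1 qr
    have hmm : Measurable mf := hm_meas qr k
    -- the splitting `G = N + c m` at every `τ < 0`
    have hsplit : ∀ τ < 0, Gf τ = Nf τ + c τ * mf τ := by
      intro τ hτ
      have e1 : Gf τ = ∫ x, ⟪u' τ x, convect (u' τ) (heatTest 1 (φs k) (qr - τ)) x⟫ :=
        integral_inner_convect_heatTest_congr_ae (huw τ hτ) _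
      rw [e1]
      simpa only [hu'_def, hNf, hmf, convect_apply] using
        integral_inner_convect_heatTest_add_const (hwm τ) (hwB τ) (hwdiv τ hτ) (c τ) eZ (hφs k).1 1 (qr - τ)
    -- honesty at `q`: `G` is integrable on every `(s, q)`
    have hGint : ∀ s < qr, IntervalIntegrable Gf volume s qr := fun s hs =>
      hu.intervalIntegrable_nonlinear_of_not_ae_const hν hmeas hq0 q.2.2 hs (hφs k).1 (hφs k).2
    -- `c m = G - N` is a.e. measurable on every `(s, q)`, hence on `Iio q`
    have hcm_s : ∀ s < qr, AEMeasurable (fun τ => c τ * mf τ) (volume.restrict (Ioo s qr)) := by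
      intro s hs
      have hGae : AEMeasurable Gf (volume.restrict (Ioo s qr)) :=
        ((hGint s hs).def'.mono_set (by rw [uIoc_of_le hs.le]; exact Ioo_subset_Ioc_self)).aestronglyMeasurable.aemeasurable
      refine (hGae.sub hNm.aemeasurable).congr ?_
      refine (ae_restrict_mem measurableSet_Ioo).mono fun τ hτ => ?_
      have hτ0 : τ < 0 := hτ.2.trans hq0
      show Gf τ - Nf τ = c τ * mf τ
      rw [hsplit τ hτ0]
      ring
    have hcm : AEMeasurable (fun τ => c τ * mf τ) (volume.restrict (Iio qr)) := by
      have hcover : Iio qr = ⋃ n : ℕ, Ioo (qr - ((n : ℝ) + 1)) qr := by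
        ext τ
        simp only [mem_Iio, mem_iUnion, mem_Ioo]
        constructor
        · intro hτ
          obtain ⟨n, hn⟩ := exists_nat_gt (qr - τ)
          exact ⟨n, by linarith, hτ⟩
        · rintro ⟨n, -, hn2⟩
          exact hn2
      rw [hcover]
      exact aemeasurable_iUnion_iff.2 fun n => hcm_s _ (by linarith)
    -- on `A q k`, `m ≠ 0` and `c = (c m) / m`
    have hAsub : A q k ⊆ Iio qr := fun τ hτ => hτ.1
    have hcmA : AEMeasurable (fun τ => c τ * mf τ) (volume.restrict (A q k)) :=
      hcm.mono_measure (Measure.restrict_mono hAsub le_rfl)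
    refine ((hcmA.div hmm.aemeasurable).congr ?_)
    refine (ae_restrict_mem (hAm q k)).mono fun τ hτ => ?_
    show c τ * mf τ / mf τ = c τ
    exact mul_div_cancel_right₀ _ hτ.2
  have hcG : AEMeasurable c (volume.restrict Gd) := aemeasurable_iUnion_iff.2 fun p => hcA p.1 p.2
  -- the measurable, bounded substitute `ct` of `c`: `ct = c` a.e. on `Gd`, `ct = 0` off `Gd`
  set c₁ : ℝ → ℝ := hcG.mk c with hc₁_def
  have hc₁m : Measurable c₁ := hcG.measurable_mk
  have hcc₁ : ∀ᵐ τ ∂(volume.restrict Gd), c τ = c₁ τ := hcG.ae_eq_mk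
  set ct : ℝ → ℝ := Gd.indicator fun τ => max (-M) (min M (c₁ τ)) with hct_def
  have hctm : Measurable ct := (measurable_const.max (measurable_const.min hc₁m)).indicator hGm
  have hclip : ∀ y : ℝ, |max (-M) (min M y)| ≤ M := fun y =>
    abs_le.2 ⟨le_max_left _ _, max_le (by linarith) (min_le_left _ _)⟩
  have hctb : ∀ τ, |ct τ| ≤ M := by
    intro τ
    by_cases hτ : τ ∈ Gd
    · rw [hct_def, indicator_of_mem hτ]; exact hclip _
    · rw [hct_def, indicator_of_notMem hτ, abs_zero]; exact hM0
  have hct_on : ∀ᵐ τ ∂(volume : Measure ℝ), τ ∈ Gd → ct τ = c τ := by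
    have h1 : ∀ᵐ τ ∂(volume : Measure ℝ), τ ∈ Gd → c τ = c₁ τ := (ae_restrict_iff' hGm).1 hcc₁
    filter_upwards [h1] with τ hτ hmem
    have hc0 : |c τ| ≤ M := hcb τ (hGd0 hmem)
    rw [hct_def, indicator_of_mem hmem, ← hτ hmem]
    rw [abs_le] at hc0
    rw [min_eq_right hc0.2, max_eq_right hc0.1]
  -- (viii) off `Gd` the slices are invariant under the vertical translations
  have hinv_off : ∀ τ < 0, τ ∉ Gd → ∀ h : ℝ,
      (fun x => u τ (x + h • eZ)) =ᵐ[volume] u τ := by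
    intro τ hτ hτG
    refine ae_eq_comp_add_smul_of_forall_integral_inner_fderiv_eq_zero (hmeas τ hτ) (hM τ hτ) (hu.1.1 τ hτ)
      (fun φ hφ hdivφ => ?_)
    have hφ1 : ContDiff ℝ 1 φ := hφ.contDiff.of_le (by exact_mod_cast le_top)
    by_cases hacc : ∀ ε > (0 : ℝ), ∃ q : ℚ, q ∈ H ∧ τ < q ∧ (q : ℝ) < τ + ε
    · -- honest rational final times accumulate at `τ⁺`
      choose q hqH hτq hqε using fun n : ℕ => hacc (1 / ((n : ℝ) + 1)) (by positivity)
      have hσpos : ∀ n, 0 < (q n : ℝ) - τ := fun n => sub_pos.2 (hτq n)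
      have hσ : Tendsto (fun n => (q n : ℝ) - τ) atTop (𝓝 0) := by
        refine squeeze_zero (fun n => (hσpos n).le) (fun n => ?_) tendsto_one_div_add_atTop_nhds_zero_nat
        linarith [hqε n]
      -- `m^{qₙ}_k(τ) = 0`: otherwise `τ ∈ Gd`
      have hm0 : ∀ n k, ∫ x, ⟪w τ x, fderiv ℝ (heatTest 1 (φs k) ((q n : ℝ) - τ)) x eZ⟫ = 0 := by
        intro n k
        by_contra hne
        exact hτG (mem_iUnion.2 ⟨⟨⟨q n, hqH n⟩, k⟩, hτq n, hne⟩)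
      -- transfer from `w τ` to `u τ = w τ + c τ e_z`
      have htrans : ∀ ψ : EuclideanSpace ℝ (Fin 3) → EuclideanSpace ℝ (Fin 3),
          FunctionSpaces.IsTestFunctionOn (⊤ : Opens (EuclideanSpace ℝ (Fin 3))) ψ → ∀ σ : ℝ,
          ∫ x, ⟪u τ x, fderiv ℝ (heatTest 1 ψ σ) x eZ⟫ = ∫ x, ⟪w τ x, fderiv ℝ (heatTest 1 ψ σ) x eZ⟫ := by
        intro ψ hψ σ
        have hψ1 : ContDiff ℝ 1 ψ := hψ.contDiff.of_le (by exact_mod_cast le_top)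
        have hDc : Continuous fun z => fderiv ℝ ψ z eZ := (hψ1.continuous_fderiv one_ne_zero).clm_apply continuous_const
        have hDi : Integrable fun x => fderiv ℝ (heatTest 1 ψ σ) x eZ := by
          have : Integrable (heatFlow (fun z => fderiv ℝ ψ z eZ) (1 * σ)) :=
            integrable_heatFlow (hDc.integrable_of_hasCompactSupport (hψ.hasCompactSupport.fderiv_apply (𝕜 := ℝ) eZ)) _
          exact this.congr (Eventually.of_forall fun x => (fderiv_heatFlow_apply hψ1 hψ.hasCompactSupport _ x eZ).symm)
        have i1 : Integrable fun x => ⟪w τ x, fderiv ℝ (heatTest 1 ψ σ) x eZ⟫ :=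
          integrable_inner_of_aestronglyMeasurable_of_norm_le (hwm τ) (hwB τ) hDi
        have i2 : Integrable fun x => ⟪c τ • eZ, fderiv ℝ (heatTest 1 ψ σ) x eZ⟫ := hDi.const_inner _
        have h0 : ∫ x, ⟪c τ • eZ, fderiv ℝ (heatTest 1 ψ σ) x eZ⟫ = 0 :=
          integral_inner_const_fderiv_heatFlow_eq_zero hψ1 hψ.hasCompactSupport (1 * σ) (c τ • eZ) eZ
        calc ∫ x, ⟪u τ x, fderiv ℝ (heatTest 1 ψ σ) x eZ⟫
            = ∫ x, (⟪w τ x, fderiv ℝ (heatTest 1 ψ σ) x eZ⟫ + ⟪c τ • eZ, fderiv ℝ (heatTest 1 ψ σ) x eZ⟫) :=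
              integral_congr_ae (by filter_upwards [huw τ hτ] with x hx; rw [hx, inner_add_left])
          _ = ∫ x, ⟪w τ x, fderiv ℝ (heatTest 1 ψ σ) x eZ⟫ := by rw [integral_add i1 i2, h0, add_zero]
      have hzero_u : ∀ n k, ∫ x, ⟪u τ x, fderiv ℝ (heatTest 1 (φs k) ((q n : ℝ) - τ)) x eZ⟫ = 0 :=
        fun n k => by rw [htrans _ (hφs k).1, hm0]
      have hall : ∀ n, ∫ x, ⟪u τ x, fderiv ℝ (heatTest 1 φ ((q n : ℝ) - τ)) x eZ⟫ = 0 := fun n =>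
        integral_inner_fderiv_heatTest_eq_zero_of_dense (hmeas τ hτ) (hM τ hτ) hφs hdense
          (by simpa using hσpos n) (hzero_u n) hφ hdivφ
      exact integral_inner_fderiv_eq_zero_of_tendsto (hmeas τ hτ) (hM τ hτ) hν hσpos hσ hφ hall
    · -- the a.e.-constant rational slices accumulate at `τ⁺`: `u τ` is itself a.e. constant
      push Not at hacc
      obtain ⟨ε, hε, hfar⟩ := hacc
      have hδ : 0 < min ε (-τ) := lt_min hε (by linarith)
      -- rationals `r n ∈ (τ, τ + min ε (-τ) / (n + 2))`
      have hr : ∀ n : ℕ, ∃ r : ℚ, τ < r ∧ (r : ℝ) < τ + min ε (-τ) / ((n : ℝ) + 2) := fun n =>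
        exists_rat_btwn (lt_add_of_pos_right τ (by positivity))
      choose r hτr hrδ using hr
      have hr0 : ∀ n, (r n : ℝ) < 0 := by
        intro n
        have h1 : min ε (-τ) / ((n : ℝ) + 2) ≤ min ε (-τ) / 2 :=
          div_le_div_of_nonneg_left hδ.le (by norm_num) (by linarith [(Nat.cast_nonneg n : (0 : ℝ) ≤ n)])
        have h2 : min ε (-τ) ≤ -τ := min_le_right _ _
        linarith [hrδ n]
      have hrε : ∀ n, (r n : ℝ) < τ + ε := by
        intro n
        have h1 : min ε (-τ) / ((n : ℝ) + 2) ≤ min ε (-τ) / 1 :=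
          div_le_div_of_nonneg_left hδ.le one_pos (by linarith [(Nat.cast_nonneg n : (0 : ℝ) ≤ n)])
        have h2 : min ε (-τ) ≤ ε := min_le_left _ _
        linarith [hrδ n]
      -- these slices are a.e. constant (the `r n` are not honest)
      have hrconst : ∀ n, ∃ κ : EuclideanSpace ℝ (Fin 3), u (r n) =ᵐ[volume] fun _ => κ := by
        intro n
        by_contra hne
        push Not at hne
        have hmem : r n ∈ H := ⟨hr0 n, fun κ => hne κ⟩
        linarith [hfar (r n) hmem (hτr n), hrε n]
      have hrt : Tendsto (fun n => (r n : ℝ)) atTop (𝓝[Iio 0] τ) := by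
        refine tendsto_nhdsWithin_iff.2 ⟨?_, Eventually.of_forall hr0⟩
        have hup : Tendsto (fun n : ℕ => τ + min ε (-τ) / ((n : ℝ) + 2)) atTop (𝓝 τ) := by
          have h1 : Tendsto (fun n : ℕ => min ε (-τ) / ((n : ℝ) + 2)) atTop (𝓝 0) := by
            have := (tendsto_one_div_add_atTop_nhds_zero_nat.comp (tendsto_add_atTop_nat 1)).const_mul (min ε (-τ))
            rw [mul_zero] at this
            refine this.congr fun n => ?_
            simp only [Function.comp_apply, Nat.cast_add, Nat.cast_one]
            ring
          simpa using h1.const_add τ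
        exact tendsto_of_tendsto_of_tendsto_of_le_of_le tendsto_const_nhds hup (fun n => (hτr n).le) fun n => (hrδ n).le
      have hpair0 : ∀ θ : EuclideanSpace ℝ (Fin 3) → EuclideanSpace ℝ (Fin 3),
          FunctionSpaces.IsTestFunctionOn (⊤ : Opens (EuclideanSpace ℝ (Fin 3))) θ → VectorCalculus.IsDivFree θ →
          ∫ x, ⟪u τ x, θ x⟫ = 0 := by
        intro θ hθ hdivθ
        have hθ1 : ContDiff ℝ 1 θ := hθ.contDiff.of_le (by exact_mod_cast le_top)
        have hcont := hu.continuousOn_integral_inner hν hmeas hθ hdivθ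
        have hlim : Tendsto (fun n => ∫ x, ⟪u (r n) x, θ x⟫) atTop (𝓝 (∫ x, ⟪u τ x, θ x⟫)) :=
          (hcont τ hτ).tendsto.comp hrt
        have hvals : ∀ n, ∫ x, ⟪u (r n) x, θ x⟫ = 0 := by
          intro n
          obtain ⟨κ, hκ⟩ := hrconst n
          rw [integral_congr_ae (show (fun x => ⟪u (r n) x, θ x⟫) =ᵐ[volume] fun x => ⟪κ, θ x⟫ by
            filter_upwards [hκ] with x hx; rw [hx])]
          exact integral_inner_const_eq_zero_of_isDivFree κ hθ1 hθ.hasCompactSupport hdivθ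
        exact tendsto_nhds_unique hlim (tendsto_const_nhds.congr fun n => (hvals n).symm)
      obtain ⟨κ, hκ⟩ := IsWeaklyDivFree.exists_ae_eq_const_of_norm_le_of_forall_integral_inner_eq_zero
        (hmeas τ hτ) (hM τ hτ) (hu.1.1 τ hτ) hpair0
      have hDi : Integrable fun x => fderiv ℝ φ x eZ :=
        ((hφ1.continuous_fderiv one_ne_zero).clm_apply continuous_const).integrable_of_hasCompactSupport
          (hφ.hasCompactSupport.fderiv_apply (𝕜 := ℝ) eZ)
      calc ∫ x, ⟪u τ x, fderiv ℝ φ x eZ⟫ = ∫ x, ⟪κ, fderiv ℝ φ x eZ⟫ :=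
            integral_congr_ae (by filter_upwards [hκ] with x hx; rw [hx])
        _ = ⟪κ, ∫ x, fderiv ℝ φ x eZ⟫ := integral_inner hDi κ
        _ = 0 := by rw [integral_fderiv_apply_eq_zero hφ1 hφ.hasCompactSupport eZ, inner_zero_right]
  -- (ix) the drift lemma: `ũ = w + ct e_z = u' + (ct - c) e_z` is a bounded ancient mild solution
  set d : ℝ → ℝ := fun τ => ct τ - c τ with hd_def
  have hd : ∃ D : ℝ, ∀ t < 0, |d t| ≤ D := ⟨M + M, fun t ht =>
    (abs_sub _ _).trans (add_le_add (hctb t) (hcb t ht))⟩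
  have hinv : ∀ᵐ τ ∂((volume : Measure ℝ).restrict (Iio 0)),
      d τ = 0 ∨ ∀ h : ℝ, (fun x => u' τ (x + h • eZ)) =ᵐ[volume] u' τ := by
    filter_upwards [ae_restrict_of_ae (s := Iio (0 : ℝ)) hct_on, ae_restrict_mem measurableSet_Iio] with τ hτG hτ0
    by_cases hmem : τ ∈ Gd
    · left
      show ct τ - c τ = 0
      rw [hτG hmem, sub_self]
    · right
      intro h
      have e1 : (fun x => u' τ (x + h • eZ)) =ᵐ[volume] fun x => u τ (x + h • eZ) :=
        (measurePreserving_add_right volume (h • eZ)).quasiMeasurePreserving.ae_eq (hu'u τ hτ0)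
      exact e1.trans ((hinv_off τ hτ0 hmem h).trans (hu'u τ hτ0).symm)
  have hsol := hu'sol.add_timeConst_smul_of_ae_invariant hu'meas eZ hd hinv
  have hũ_eq : (fun t x => u' t x + d t • eZ) = fun t x => w t x + ct t • eZ := by
    funext t x
    simp only [hu'_def, hd_def, sub_smul]
    abel
  rw [hũ_eq] at hsol
  -- (x) `ũ` is a bounded weak solution, axisymmetric and swirl-free a.e.
  have hũjoint : AEStronglyMeasurable (uncurry fun t x => w t x + ct t • eZ)
      ((volume : Measure (ℝ × EuclideanSpace ℝ (Fin 3))).restrict (Iio 0 ×ˢ univ)) :=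
    (hw.add ((hctm.comp measurable_fst).stronglyMeasurable.smul_const eZ)).aestronglyMeasurable
  have hũsl : ∀ t < 0, AEStronglyMeasurable (fun x => w t x + ct t • eZ) volume := fun t _ =>
    (hwm t).add aestronglyMeasurable_const
  have hweak := hsol.isBoundedWeakNSSolutionOn hν hũjoint hũsl
  have hũU : ∀ t < 0, (fun x => w t x + ct t • eZ) =ᵐ[volume] fun x => u t x + (ct t - c t) • eZ := fun t ht => by
    filter_upwards [hwu' t ht] with x hx
    rw [hx, sub_smul]
    abel
  have haxiU : ∀ t < 0, IsAxisymmetric fun x => u t x + (ct t - c t) • eZ := fun t ht =>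
    isAxisymmetric_add_smul_eZ (haxi t ht) _
  have hswU : ∀ t < 0, HasNoSwirl fun x => u t x + (ct t - c t) • eZ := fun t ht =>
    hasNoSwirl_add_smul_eZ (hswirl t ht) _
  have hax : ∀ θ : ℝ, ∀ᵐ t ∂((volume : Measure ℝ).restrict (Iio 0)),
      (fun x => (fun x => w t x + ct t • eZ) (rotZ θ x)) =ᵐ[volume] fun x => rotZ θ ((fun x => w t x + ct t • eZ) x) := by
    intro θ
    filter_upwards [ae_restrict_mem measurableSet_Iio] with t ht
    have e1 : (fun x => (fun x => w t x + ct t • eZ) (rotZ θ x)) =ᵐ[volume]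
        fun x => u t (rotZ θ x) + (ct t - c t) • eZ :=
      (measurePreserving_rotZ θ).quasiMeasurePreserving.ae_eq (hũU t ht)
    have e2 : (fun x => rotZ θ ((fun x => w t x + ct t • eZ) x)) =ᵐ[volume]
        fun x => rotZ θ (u t x + (ct t - c t) • eZ) := by
      filter_upwards [hũU t ht] with x hx
      simp only [hx]
    have e3 : (fun x => u t (rotZ θ x) + (ct t - c t) • eZ) =ᵐ[volume]
        fun x => rotZ θ (u t x + (ct t - c t) • eZ) :=
      Eventually.of_forall fun x => haxiU t ht θ x
    exact e1.trans (e3.trans e2.symm)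
  have hsw : ∀ᵐ t ∂((volume : Measure ℝ).restrict (Iio 0)),
      swirl (fun x => w t x + ct t • eZ) =ᵐ[volume] (0 : EuclideanSpace ℝ (Fin 3) → ℝ) := by
    filter_upwards [ae_restrict_mem measurableSet_Iio] with t ht
    filter_upwards [hũU t ht] with x hx
    have : swirl (fun x => w t x + ct t • eZ) x = swirl (fun y => u t y + (ct t - c t) • eZ) x := by
      simp only [swirl, hx]
    rw [this]
    exact hswU t ht x
  obtain ⟨b, -, -, hb⟩ := h52 hweak hax hsw
  -- the slices of `u` are a.e. constant for a.e. `t`, hence for every `t`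
  have hconst : ∀ᵐ t ∂((volume : Measure ℝ).restrict (Iio 0)),
      u t =ᵐ[volume] fun _ => (b t - (ct t - c t)) • eZ := by
    filter_upwards [hb, ae_restrict_mem measurableSet_Iio] with t hbt ht
    filter_upwards [hbt, hũU t ht] with x hx hx'
    have hx2 : w t x + ct t • eZ = b t • eZ := hx
    have e : u t x = (w t x + ct t • eZ) - (ct t - c t) • eZ := by rw [hx']; abel
    rw [e, hx2]
    simp only [sub_smul]
  intro t ht
  obtain ⟨κ, hκ⟩ := hu.exists_ae_eq_const_slice hν hmeas hconst t ht
  have hax' := eq_smul_eZ_of_ae_eq_const_of_isAxisymmetric (haxi t ht) hκ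
  refine ⟨κ 2, ?_⟩
  rw [hax'] at hκ
  exact hκ

/-- **KNSS 2009, Theorem 5.2: the `ℝ³`-valued slice-wise fact `knss_axisymmetric_no_swirl'` follows
from the theorem in print** (through `knss_axisymmetric_no_swirl_of_KNSS2009`, taking
`b = β e_z`). [cite: KochNadirashviliSereginSverak2009, Thm 5.2 (arXiv pp. 9–10)] -/
theorem knss_axisymmetric_no_swirl'_of_KNSS2009 (h52 : KNSS2009_liouville_axisymmetric_no_swirl) :
    knss_axisymmetric_no_swirl' := fun hu hmeas haxi hswirl t ht =>
  let ⟨β, hβ⟩ := knss_axisymmetric_no_swirl_of_KNSS2009 h52 hu hmeas haxi hswirl t ht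
  ⟨β • eZ, hβ⟩

/-- **`knss_axisymmetric_no_swirl` from KNSS's Proposition 4.1 alone**: the printed Theorem 5.2
follows from the §4 regularity fact `KNSS2009_prop41_mild` (`KNSSThm52OfProp41`), and the
slice-wise fact from the printed theorem (`knss_axisymmetric_no_swirl_of_KNSS2009`). When
`KNSS2009_prop41_mild` is discharged this is `knss_axisymmetric_no_swirl_holds`.
[cite: KochNadirashviliSereginSverak2009, Thm 5.2 with Prop. 4.1 (arXiv pp. 8–10)] -/
theorem knss_axisymmetric_no_swirl_of_prop41_mild (h41 : KNSS2009_prop41_mild) :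
    knss_axisymmetric_no_swirl :=
  knss_axisymmetric_no_swirl_of_KNSS2009 (KNSS2009_liouville_axisymmetric_no_swirl_of_prop41_mild h41)

/-- **`knss_axisymmetric_no_swirl'` from KNSS's Proposition 4.1 alone.** When
`KNSS2009_prop41_mild` is discharged this is `knss_axisymmetric_no_swirl'_holds`.
[cite: KochNadirashviliSereginSverak2009, Thm 5.2 with Prop. 4.1 (arXiv pp. 8–10)] -/
theorem knss_axisymmetric_no_swirl'_of_prop41_mild (h41 : KNSS2009_prop41_mild) :
    knss_axisymmetric_no_swirl' :=
  knss_axisymmetric_no_swirl'_of_KNSS2009 (KNSS2009_liouville_axisymmetric_no_swirl_of_prop41_mild h41)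

end Bridge

end Literature.Analysis.FluidPDE
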